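import Summits.Schanuel.Schanuel.Theorems.SoloInformedX193Laws
import Summits.Schanuel.Schanuel.Theorems.SoloInformedX193PairLaws
import Summits.Schanuel.Schanuel.Theorems.SoloInformedX193Twists
import Summits.Schanuel.Schanuel.Theorems.SoloInformedX193Finite

/-!
# X193 kernel, file F12 — THEOREM X193-K (assembly)

Solo-informed Schanuel programme (toy line X), kernel of Roy's small value programme
[Roy2010]: the additive small value estimate at the multiples `iξ` of a transcendental `ξ`,
with NO derivatives (`τ = 0`), holds for every exponent

  `ν > ν*(β, σ) := 1 + β − σβ/(β + σ) = 1 + β − σ + σ²/(β + σ)`   (`β > 2`, `0 < σ < 1`),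

CONDITIONALLY on Roy's resultant estimate [Roy2010, Prop. 3.1], typed as the named fact
`Literature.NumberTheory.Transcendental.Roy2010.prop_3_1` and taken as a hypothesis:

  `soloX_theoremX193 : Transcendental ℚ ξ → prop_3_1 → 2 < β → 0 < σ → σ < 1 →
      Set.Ioi (1 + β - σ * β / (β + σ)) ⊆ royAdditiveSVEExponents ξ β σ 0`.

For comparison (all in the tree): the box principle forbids `ν < 1 + β − σ`
(`royAdditiveSVEExponents_subset_Ici`, file `SoloInformedRoyAdditiveDirichlet`), the one-point
Gel'fond argument gives every `ν > 1 + β` (`Ioi_subset_royAdditiveSVEExponents`), and Roy's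
theorem [Roy2010, Thm 1.1 (3)] (the named fact `thm_1_1_part3`, not proved in the tree) gives
every `ν > 1 + β − (3/4)σ`; the present threshold is within `σ²/(β + σ)` of the box principle
(`soloX_threshold_gap`) and beats `1 + β − (3/4)σ` exactly when `σ < β/3`
(`soloX_threshold_lt_roy_iff`) — in particular whenever `σ ≤ 2/3`, as `β > 2`.

PROOF (the assembly of files F1–F11).  Suppose `ν* < ν < 1 + β` is not an exponent: then from
some level `n₀` on there are `R n ∈ RoyAdditiveSmall ξ β σ 0 ν n` (choice).  The pieces of
`(R n)` (normalised irreducible factors of positive degree other than `T`) form the concrete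
service data `soloX_pieces ξ R` (F8), which satisfies the seven primitive laws: (WF) F9a,
(Bud) + (S) F9b, (PAIR) + (L1) F10 [cond `prop_3_1`], (TW) F11a, (FIN) F11b.  The abstract
capstone `SoloServiceData.false_of_laws` (F7, layer A: service identity, exceptional count,
cheap assignability, no cheap depth, deep uniqueness, liquidity count) refutes the seven laws
for the exponent `γ := ν − 1 − β + σ`, which lies in the admissible range `γ < σ`,
`σ² < γ(β + σ)` exactly because `ν* < ν < 1 + β` (`soloX_window_exponent`).  Exponents
`ν ≥ 1 + β` follow since the exponent set is an upper set.  A corollary restates the theorem in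
Roy's wording (`HeightData`, `∃ᶠ n, ∃ i ≤ n^σ, j ≤ n^0, exp(−n^ν) < |P_n^{[j]}(iξ)|`).

Conditional on `prop_3_1` only (a published theorem, [Roy2010, Prop. 3.1]); no sorries.
-/

namespace Summit.Schanuel.Schanuel.Theorems

open Polynomial Filter
open Literature.NumberTheory.Transcendental.Roy2010

/-! ### The threshold `ν* = 1 + β − σβ/(β+σ)` -/

/-- For `ν` in the window `(ν*, 1 + β)` the exponent `γ := ν − 1 − β + σ` meets the three
constraints of `false_of_laws`: `γ < σ`, `σ² < γ (β + σ)`, `ν + (σ − γ) = 1 + β`. -/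
theorem soloX_window_exponent {β σ ν : ℝ} (hbs : 0 < β + σ)
    (hν : 1 + β - σ * β / (β + σ) < ν) (hν' : ν < 1 + β) :
    ν - 1 - β + σ < σ ∧ σ ^ 2 < (ν - 1 - β + σ) * (β + σ) ∧
      ν + (σ - (ν - 1 - β + σ)) = 1 + β := by
  refine ⟨by linarith, ?_, by ring⟩
  have h' : 1 + β - ν < σ * β / (β + σ) := by linarith
  have h1 : (1 + β - ν) * (β + σ) < σ * β := (lt_div_iff₀ hbs).mp h'
  have h2 : (ν - 1 - β + σ) * (β + σ) = σ * β + σ ^ 2 - (1 + β - ν) * (β + σ) := by ring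
  rw [h2]; linarith

/-- The threshold lies strictly below the Gel'fond ceiling `1 + β` (`β, σ > 0`). -/
theorem soloX_threshold_lt {β σ : ℝ} (hβ : 0 < β) (hσ : 0 < σ) :
    1 + β - σ * β / (β + σ) < 1 + β := by
  have : 0 < σ * β / (β + σ) := div_pos (mul_pos hσ hβ) (by linarith)
  linarith

/-- The gap to the box-principle threshold `1 + β − σ` is `σ²/(β + σ)`. -/
theorem soloX_threshold_gap {β σ : ℝ} (h : β + σ ≠ 0) :
    (1 + β - σ * β / (β + σ)) - (1 + β - σ) = σ ^ 2 / (β + σ) := by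
  field_simp
  ring

/-- Comparison with [Roy2010, Thm 1.1 (3)] at `τ = 0`: `ν* < 1 + β − (3/4)σ ↔ σ < β/3`
(`β, σ > 0`). -/
theorem soloX_threshold_lt_roy_iff {β σ : ℝ} (hβ : 0 < β) (hσ : 0 < σ) :
    1 + β - σ * β / (β + σ) < 1 + β - 3 / 4 * σ ↔ σ < β / 3 := by
  have hbs : 0 < β + σ := by linarith
  constructor
  · intro h
    have h1 : 3 / 4 * σ < σ * β / (β + σ) := by linarith
    rw [lt_div_iff₀ hbs] at h1
    nlinarith
  · intro h
    have h1 : 3 / 4 * σ * (β + σ) < σ * β := by nlinarith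
    have h2 : 3 / 4 * σ < σ * β / (β + σ) := (lt_div_iff₀ hbs).mpr h1
    linarith

/-! ### No Roy data in the window -/

/-- **The contradiction.**  For `ξ` transcendental, `prop_3_1`, `β > 2`, `0 < σ < 1` and
`ν* < ν < 1 + β`, there is no sequence `R n ∈ RoyAdditiveSmall ξ β σ 0 ν n` (`n ≥ n₀`): its
pieces would satisfy the seven laws, which `SoloServiceData.false_of_laws` refutes at
`γ = ν − 1 − β + σ`. -/
theorem soloX_no_roy_data {ξ : ℂ} (hξ : Transcendental ℚ ξ) (hP31 : prop_3_1) {β σ ν : ℝ}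
    (hβ : 2 < β) (hσ0 : 0 < σ) (hσ1 : σ < 1) (hν : 1 + β - σ * β / (β + σ) < ν)
    (hν' : ν < 1 + β) {R : ℕ → ℤ[X]} {n₀ : ℕ}
    (hR : ∀ n, n₀ ≤ n → R n ∈ RoyAdditiveSmall ξ β σ 0 ν n) : False := by
  have hξ0 : ξ ≠ 0 := soloX_ne_zero_of_transcendental hξ
  obtain ⟨hγσ, hthr, hνγ⟩ := soloX_window_exponent (by linarith : 0 < β + σ) hν hν'
  exact (soloX_pieces ξ R).false_of_laws (soloX_pieces_wellFormed hξ0 R) (soloX_c₀_nonneg ξ)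
    (soloX_pieces_budgetLaw hR) (soloX_pieces_serviceLaw hξ hR) (soloX_pieces_pairLaw hξ hP31 R)
    (soloX_pieces_entryLaw hξ hP31 hσ0 hσ1.le hR) (soloX_pieces_twistLaw hξ R)
    (soloX_pieces_finiteLaw hξ0 R) hβ hσ0 hσ1.le hγσ hthr hνγ (by norm_num)
    (soloX_pairConst_nonneg ξ) (soloX_pairConst_nonneg ξ)

/-- **The window.**  Every `ν ∈ (ν*, 1 + β)` is an exponent of the additive small value
estimate at `ξ` (`τ = 0`). -/
theorem soloX_Ioo_subset_royAdditiveSVEExponents {ξ : ℂ} (hξ : Transcendental ℚ ξ)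
    (hP31 : prop_3_1) {β σ : ℝ} (hβ : 2 < β) (hσ0 : 0 < σ) (hσ1 : σ < 1) :
    Set.Ioo (1 + β - σ * β / (β + σ)) (1 + β) ⊆ royAdditiveSVEExponents ξ β σ 0 := by
  intro ν hν
  by_contra hcon
  have hev : ∀ᶠ n : ℕ in atTop, (RoyAdditiveSmall ξ β σ 0 ν n).Nonempty :=
    (Filter.not_frequently.mp hcon).mono fun n hn => not_not.mp hn
  obtain ⟨n₀, hn₀⟩ := Filter.eventually_atTop.mp hev
  have hex : ∀ n : ℕ, ∃ P : ℤ[X], n₀ ≤ n → P ∈ RoyAdditiveSmall ξ β σ 0 ν n := fun n => by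
    by_cases h : n₀ ≤ n
    · exact ⟨(hn₀ n h).some, fun _ => (hn₀ n h).some_mem⟩
    · exact ⟨0, fun h' => absurd h' h⟩
  choose R hR using hex
  exact soloX_no_roy_data hξ hP31 hβ hσ0 hσ1 hν.1 hν.2 hR

/-- **THEOREM X193-K** [cond `prop_3_1`].  For `ξ ∈ ℂ` transcendental, `β > 2` and
`0 < σ < 1`: every `ν > 1 + β − σβ/(β + σ)` is an exponent of the additive small value estimate
at the multiples of `ξ` without derivatives —
`Set.Ioi (1 + β − σβ/(β+σ)) ⊆ royAdditiveSVEExponents ξ β σ 0`. -/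
theorem soloX_theoremX193 {ξ : ℂ} (hξ : Transcendental ℚ ξ) (hP31 : prop_3_1) {β σ : ℝ}
    (hβ : 2 < β) (hσ0 : 0 < σ) (hσ1 : σ < 1) :
    Set.Ioi (1 + β - σ * β / (β + σ)) ⊆ royAdditiveSVEExponents ξ β σ 0 := by
  intro ν hν
  rw [Set.mem_Ioi] at hν
  have hlt : 1 + β - σ * β / (β + σ) < 1 + β := soloX_threshold_lt (by linarith) hσ0
  by_cases h : ν < 1 + β
  · exact soloX_Ioo_subset_royAdditiveSVEExponents hξ hP31 hβ hσ0 hσ1 ⟨hν, h⟩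
  · have hmid : (1 + β - σ * β / (β + σ) + (1 + β)) / 2 ∈
        Set.Ioo (1 + β - σ * β / (β + σ)) (1 + β) := ⟨by linarith, by linarith⟩
    have hmem := soloX_Ioo_subset_royAdditiveSVEExponents hξ hP31 hβ hσ0 hσ1 hmid
    exact isUpperSet_royAdditiveSVEExponents ξ β σ 0 (by linarith) hmem

/-! ### Roy's wording -/

/-- The naive height `polyHeight` (an integer) is at most Mathlib's `supNorm` (they are equal;
with `supNorm_le_polyHeight` of `SoloInformedRoyAdditiveGelfond`). -/
theorem soloX_polyHeight_le_supNorm (P : ℤ[X]) : (polyHeight P : ℝ) ≤ P.supNorm := by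
  by_cases hs : P.support.Nonempty
  · obtain ⟨i, -, hi⟩ := Finset.exists_mem_eq_sup P.support hs fun k => (P.coeff k).natAbs
    rw [polyHeight, hi, Nat.cast_natAbs, Int.cast_abs, ← Int.norm_eq_abs]
    exact P.le_supNorm i
  · rw [Finset.not_nonempty_iff_eq_empty, Polynomial.support_eq_empty] at hs
    simp [hs, polyHeight]

/-- **X193-K in Roy's wording** (`τ = 0`, cf. `thm_1_1_part3`): for `ξ` transcendental,
`prop_3_1`, `β > 2`, `0 < σ < 1`, `ν > 1 + β − σβ/(β + σ)` and every sequence of non-zero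
`P n ∈ ℤ[T]` (`n ≥ n₀`) with `deg P n ≤ n`, `‖P n‖_∞ ≤ exp(n^β)`: for infinitely many `n`,
`max {|P_n^{[j]}(iξ)| ; i ≤ n^σ, j ≤ n^0} > exp(−n^ν)`. -/
theorem soloX_theoremX193_heightData {ξ : ℂ} (hξ : Transcendental ℚ ξ) (hP31 : prop_3_1)
    {β σ ν : ℝ} (hβ : 2 < β) (hσ0 : 0 < σ) (hσ1 : σ < 1)
    (hν : 1 + β - σ * β / (β + σ) < ν) (P : ℕ → ℤ[X]) (n₀ : ℕ) (hP : HeightData β P n₀) :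
    ∃ᶠ n : ℕ in atTop, ∃ i j : ℕ, (i : ℝ) ≤ (n : ℝ) ^ σ ∧ (j : ℝ) ≤ (n : ℝ) ^ (0 : ℝ) ∧
      Real.exp (-(n : ℝ) ^ ν) < ‖aeval ((i : ℂ) * ξ) (hasseDeriv j (P n))‖ := by
  have hmem : ν ∈ royAdditiveSVEExponents ξ β σ 0 := soloX_theoremX193 hξ hP31 hβ hσ0 hσ1 hν
  have hfr : ∃ᶠ n : ℕ in atTop, ¬ (RoyAdditiveSmall ξ β σ 0 ν n).Nonempty := hmem
  refine (hfr.and_eventually (eventually_ge_atTop n₀)).mono ?_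
  rintro n ⟨hno, hn⟩
  obtain ⟨hP0, hdeg, hht⟩ := hP n hn
  by_contra hcon
  simp only [not_exists, not_and, not_lt] at hcon
  exact hno ⟨P n, hP0, hdeg, (soloX_polyHeight_le_supNorm _).trans hht,
    fun i j hi hj => hcon i j hi hj⟩

end Summit.Schanuel.Schanuel.Theorems
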